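/-
Copyright: the b2b-balaban T⁴-continuum CRUX team, row NE7b OWNER lineage `t4-ne7b-p1` (gen 124). Project licence.
-/
import Summits.QuantumFields.BalabanUV.T4Continuum.Spine.NE7b.SupZdCoarseTorusHyp

/-!
# THE THERMODYNAMIC LIMIT OF THE NEXT-SCALE HESSIAN: the inverses of the torus Schur complements `T_k = Q′H[V∘wm_k]⁻¹Q′*` (coarse
# period `3^k`; `(n+1)^dT_k⁻¹` IS the Hessian of the torus road's next-scale action, (102)∕(136)) CONVERGE to the infinite-volume kernel
# `M = T_∞⁻¹` of (194)∕(195): `|T_k⁻¹(y,y′) − M(wm y, wm y′)| ≤ c·e^{−δ(ω_k y + ω_k y′)}`, `ω_k(y) = max(0, 3^k∕2 − 2 − ρ_k(y,0))`, with `(c, δ)`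
# from `(d, a, λ, Λ)` ONLY — every mesh, every level, every `V : ℤ^d → [−λ, Λ]`, `d ≥ 3`; in particular `T_k⁻¹(σ_k b, σ_k b′) → M(b,b′)`
# exponentially fast for all `b, b′ ∈ ℤ^d` — [B4] (5.10) on the coarse torus ((198)'s hypotheses) + (194)'s infinite-volume (5.8) on the
# window (row NE7b, node U5c; (194)∕(198) + `B4Sect5Torus.sect5Uniform_holds` BY NAME; [folklore])

Cell `pub-balaban`, sub-cell `t4`, spine estimate NE7b (`T4WeightBudget.RelWeightBound`; the cell's OWN estimate — NOT PRINTED in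
[Bałaban 1983–89], NOT PROVED).  Crux-route work under `Spine/NE7b/` by the row OWNER (`t4-ne7b-p1` gen 124, file (199)) under FREEZE
(0)'s crux-prover clause; NOTHING of Bałaban's is named as a Lean object, valued or asserted; no `T4Continuum/Support` leaf typed; no `def`,
no notation (the torus kernel as `Matrix.of`, Mathlib's `Matrix.inv`, `M` ANY kernel with (194)'s cube-limit property DISPLAYED); zero
`sorry`.  Imports (BY NAME): the OWNER's (198) `…SupZdCoarseTorusHyp` (`coarse_torus_hyp`), and through it (197) `torusNorm_eq_l1`, (194)
`zd_coarse_inverse_exists`, `natAbs_le_l1`, (180) `torusNorm_le_l1`, `inWindow_of_le`, (132) `isPseudoDist_torus`, `sumBound_torus`, the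
Literature engine `B4Sect5Torus.sect5Uniform_holds` (= [Balaban1983RegularityDecay] Sect. 5, clause (5.10), PROVED in the tree), the
window kit, Mathlib's `Matrix.inv_submatrix_equiv`, `tendsto_of_tendsto_of_tendsto_of_le_of_le'`, `Real.tendsto_exp_atBot`.

WHY (located).  § [NE7bP1-G123-HANDOFF] NEXT (3)(a) asked for the infinite-volume next-scale Hessian; (194)∕(195) built `M = T_∞⁻¹` as
the limit of SECTION inverses and proved it is the unique bounded two-sided inverse.  What makes `(n+1)^dM` the thermodynamic limit of
the road's ACTUAL next-scale Hessians `(n+1)^dT_k⁻¹` (finite tori, periodic boundary conditions — not sections) is this file: on the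
index set `Site d (3^k)` both `T_k` and the window reading `T_∞∘wm` satisfy (5.6) and their difference satisfies (5.9) with the seam
depth ((198)), so [B4] (5.10) bounds `T_k⁻¹ − (T_∞∘wm)⁻¹` by `c₁e^{−δ₁(ρ_k + ω y + ω y′)}`; `(T_∞∘wm)⁻¹` is the inverse of the window
SECTION of `T_∞` reindexed along the bijection `wm : Site d (3^k) ≃ W ⊂ ℤ^d` (`Matrix.inv_submatrix_equiv`), which (194) (iii) places within
`c₂e^{−δ₂(margins)}` of `M`, the margins `3^k∕2 − |b|₁` of §1 dominating the seam depth.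

WHAT IS PROVED ([folklore]): §1 `window_margin` (`z ∉ wm(Site d (3^k))` ⟹ `3^k∕2 − |b|₁ ≤ |b − z|₁`); §2 **`torus_nextScale_inverse_close`**
(THE END: `∃ c δ > 0`: for ALL `n, V, Ψ`, ANY `M` with the cube-limit property, ALL `k, ψ, y, y′`:
`|T_k⁻¹(y,y′) − M(wm y, wm y′)| ≤ c·e^{−δ(ω_k y + ω_k y′)}`); §3 **`torus_nextScale_inverse_tendsto`** (for every `b, b′ ∈ ℤ^d` and every
family `ψ^k` along the tower: `T_k⁻¹(σ_k b, σ_k b′) → M(b,b′)`, via the explicit bound `c·e^{−δ(3^k − 4 − |b|₁ − |b′|₁)}` beyond the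
window radius); §4 toy.

HONEST (what this is NOT).  The LINEAR column's next-scale Hessian kernel only — the `ℤ^d` response `H_∞⁻¹Q′*M` and fluctuation
covariance, their torus limits, the `H + K` column on `ℤ^d`, and any NON-quadratic (cumulant ∕ cluster-expansion) statement are not
here; `d ≥ 3` only; scalar skeleton ((A3), NC-NE7b-α UNRULED); nothing of the covariant propagators of [B4]–[B6]; [B4] Sect. 5 is the
tree's PROVED theorem — nothing of Bałaban's asserted.  BY-NAME EFFECT ON THE WALL: NONE.  NE7b NOT PRINTED ∕ NOT PROVED; spine PROVED
0∕9; rung (B)+1 — the quadratic part of one RG step now has an infinite-volume limit, the programme's MEASURES remain FINITE-torus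
statements; NOT the mass gap, NOT Clay.  HONEST DEPENDENCY: continuum YM on T⁴ ⇐ BetaPertH ∧ nine spine estimates (0∕9 proved); BetaPertH
⇐ (D1) ∧ (D4) ∧ CAP+tail; G-an2-4 gates asym, D1 and NE2∕3∕4.
-/

set_option autoImplicit false

noncomputable section

namespace Summit.QuantumFields.BalabanUV.T4Continuum.NE7b.SupZdCoarseInverseTorusLimit

open Real Filter Topology
open Literature.MathematicalPhysics.QuantumFieldTheory.Balaban1983to89
open B6QGQLower276 (X e blk B side chart mem_B sum_B sum_B_const card_cube blk_chart)
open Beta (Site siteOf windowMap siteOf_windowMap windowMap_siteOf windowMap_injective InWindow)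
open B4Sect5Torus (IsPseudoDist SumBound Hyp56 Hyp59 sect5Uniform_holds)
open SupTorusBlockDistance (isPseudoDist_torus sumBound_torus)
open SupZdPropagatorLimit (torusNorm_le_l1 inWindow_of_le)
open SupZdCoarseInverse (zd_coarse_inverse_exists natAbs_le_l1)
open SupZdCoarseTorusSeam (torusNorm_eq_l1)
open SupZdCoarseTorusHyp (coarse_torus_hyp)

variable {d : ℕ}

/-! ## §1. The window as a finite subset of `ℤ^d`: margins -/

/-- **WINDOW MARGINS**: a point `z ∉ wm(Site d (3^k))` (the coarse window as a subset of `ℤ^d`) is at `ℓ¹` distance `≥ 3^k∕2 − |b|₁` from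
every `b` — some coordinate of `z` is outside `]−3^k∕2, 3^k∕2]`, else `z = wm(σ z)`. [folklore] -/
theorem window_margin (k : ℕ) (b z : X d) (hz : z ∉ (Finset.univ : Finset (Site d (3 ^ k))).image (windowMap d (3 ^ k))) :
    ((3 ^ k : ℕ) : ℝ) / 2 - ∑ j, (((b j).natAbs : ℕ) : ℝ) ≤ ∑ j, (((b j - z j).natAbs : ℕ) : ℝ) := by
  classical
  -- some coordinate of `z` is outside the window
  have hex : ∃ i, ¬ InWindow (3 ^ k) (z i) := by
    by_contra h
    push Not at h
    exact hz (Finset.mem_image.2 ⟨siteOf d (3 ^ k) z, Finset.mem_univ _, windowMap_siteOf d (3 ^ k) h⟩)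
  obtain ⟨i, hi⟩ := hex
  have h1 : (3 ^ k : ℕ) ≤ 2 * (z i).natAbs := by
    unfold InWindow at hi
    have e : ((z i).natAbs : ℤ) = |z i| := Int.natCast_natAbs (z i)
    rcases abs_cases (z i) with ⟨h, _⟩ | ⟨h, _⟩ <;> omega
  have h2 : (z i).natAbs ≤ (b i).natAbs + (b i - z i).natAbs := by
    have := Int.natAbs_add_le (b i) (-(b i - z i))
    rwa [show b i + -(b i - z i) = z i by ring, Int.natAbs_neg] at this
  have h3 := natAbs_le_l1 b i
  have h4 : (b i - z i).natAbs ≤ ∑ j, (b j - z j).natAbs :=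
    Finset.single_le_sum (f := fun j => (b j - z j).natAbs) (fun _ _ => Nat.zero_le _) (Finset.mem_univ i)
  have h5 : (3 ^ k : ℕ) ≤ 2 * (∑ j, (b j).natAbs) + 2 * (∑ j, (b j - z j).natAbs) := by omega
  have h6 : ((3 ^ k : ℕ) : ℝ) ≤ 2 * ∑ j, (((b j).natAbs : ℕ) : ℝ) + 2 * ∑ j, (((b j - z j).natAbs : ℕ) : ℝ) := by exact_mod_cast h5
  linarith

/-! ## §2. THE END: the torus next-scale Hessian kernels converge to the infinite-volume one, exponentially in the seam depth -/

/-- **HEADLINE — `|T_k⁻¹(y,y′) − M(wm y, wm y′)| ≤ c·e^{−δ(ω_k(y) + ω_k(y′))}`, `ω_k(y) = max(0, 3^k∕2 − 2 − ρ_k(y,0))`**: `d ≥ 3`, `a > 0`,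
`λ < min(2,a)`, `Λ ≥ 0` ⟹ `∃ c δ > 0` (from `(d, a, λ, Λ)` ONLY) such that for ALL `n`, `V : ℤ^d → [−λ, Λ]`, ANY bounded `ℤ^d` block columns
`Ψ`, ANY kernel `M` with (194)'s cube-limit property, every level `k`, ANY torus block columns `ψ` of `H[V∘wm_k]` and all coarse sites
`y, y′`: the inverse of the torus Schur complement (= `(n+1)^{−d}×` the Hessian of the next-scale action, (102)∕(136)) is within
`c·e^{−δ(ω_k y + ω_k y′)}` of `M` read on the window — [B4] (5.10) on the coarse torus ((198)'s hypotheses, `B4Sect5Torus.sect5Uniform_holds`)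
between `T_k` and `T_∞∘wm`, the reindexing `(T_∞∘wm)⁻¹ = ((T_∞)_W)⁻¹∘wm` along `wm : Site d (3^k) ≃ W`, and (194) (5.8) at `S′ = ℤ^d` for
the window section with the margins of §1. [folklore] -/
theorem torus_nextScale_inverse_close (hd : 3 ≤ d) (a : ℝ) (ha : 0 < a) {lam Lam : ℝ} (hlam : lam < min 2 a) (hLam : 0 ≤ Lam) :
    ∃ c δ : ℝ, 0 < c ∧ 0 < δ ∧ ∀ (n : ℕ) (V : X d → ℝ), (∀ p, -lam ≤ V p) → (∀ p, V p ≤ Lam) →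
      ∀ (Ψ : X d → X d → ℝ) (BΨ : X d → ℝ), (∀ b' p, |Ψ b' p| ≤ BΨ b') →
      (∀ b' p, ((n : ℝ) + 1) ^ 2 * ∑ μ, (2 * Ψ b' p - Ψ b' (p + e μ) - Ψ b' (p - e μ))
        + a / ((n : ℝ) + 1) ^ d * ∑ q ∈ B n (blk n p), Ψ b' q + V p * Ψ b' p = if blk n p = b' then 1 else 0) →
      ∀ (M : X d → X d → ℝ), (∀ b b' : X d, Tendsto (fun R : ℕ =>
          if h : b ∈ (Fintype.piFinset fun _ : Fin d => Finset.Icc (-(R : ℤ)) R) ∧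
              b' ∈ (Fintype.piFinset fun _ : Fin d => Finset.Icc (-(R : ℤ)) R)
            then (Matrix.of fun c c' : ↥(Fintype.piFinset fun _ : Fin d => Finset.Icc (-(R : ℤ)) R) =>
              (((n : ℝ) + 1) ^ d)⁻¹ * ∑ q ∈ B n (c : X d), Ψ (c' : X d) q)⁻¹ ⟨b, h.1⟩ ⟨b', h.2⟩ else 0)
        atTop (𝓝 (M b b'))) →
      ∀ (k : ℕ) (ψ : Site d (3 ^ k) → Site d ((n + 1) * 3 ^ k) → ℝ),
      (∀ (y' : Site d (3 ^ k)) (x : Site d ((n + 1) * 3 ^ k)),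
        ((n : ℝ) + 1) ^ 2 * ∑ μ, (2 * ψ y' x - ψ y' (x + siteOf d ((n + 1) * 3 ^ k) (e μ)) - ψ y' (x - siteOf d ((n + 1) * 3 ^ k) (e μ)))
          + a / ((n : ℝ) + 1) ^ d * ∑ q ∈ B n (blk n (windowMap d ((n + 1) * 3 ^ k) x)), ψ y' (siteOf d ((n + 1) * 3 ^ k) q)
          + V (windowMap d ((n + 1) * 3 ^ k) x) * ψ y' x
          = if siteOf d (3 ^ k) (blk n (windowMap d ((n + 1) * 3 ^ k) x)) = y' then 1 else 0) →
      ∀ y y' : Site d (3 ^ k),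
        |(Matrix.of fun y y' : Site d (3 ^ k) =>
            (((n : ℝ) + 1) ^ d)⁻¹ * ∑ z : Fin d → Fin (n + 1), ψ y' (siteOf d ((n + 1) * 3 ^ k) (chart n (windowMap d (3 ^ k) y) z)))⁻¹ y y'
          - M (windowMap d (3 ^ k) y) (windowMap d (3 ^ k) y')|
          ≤ c * exp (-(δ * (max 0 (((3 ^ k : ℕ) : ℝ) / 2 - 2 - ∑ i, ((((y i).valMinAbs).natAbs : ℕ) : ℝ))
            + max 0 (((3 ^ k : ℕ) : ℝ) / 2 - 2 - ∑ i, ((((y' i).valMinAbs).natAbs : ℕ) : ℝ))))) := by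
  classical
  obtain ⟨γ, c₀, δ₀, hγ, hc₀, hδ₀, H198⟩ := coarse_torus_hyp (d := d) hd a ha hlam hLam
  have hγ' : (0 : ℝ) < 1 / ((36 : ℝ) ^ d * (4 * d + a + Lam)) := by positivity
  have hK : ∀ α : ℝ, 0 < α → 0 ≤ (2 * (1 - exp (-α))⁻¹) ^ d := fun α hα =>
    pow_nonneg (mul_nonneg zero_le_two (inv_nonneg.2 (sub_nonneg.2 (exp_le_one_iff.2 (by linarith))))) d
  obtain ⟨c₁, δ₁, hc₁, hδ₁, H5⟩ := sect5Uniform_holds (fun α => (2 * (1 - exp (-α))⁻¹) ^ d) hK _ c₀ δ₀ hγ' hc₀ hδ₀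
  obtain ⟨c₂, δ₂, hc₂, hδ₂, H194⟩ := zd_coarse_inverse_exists (d := d) hd a ha hlam hLam
  refine ⟨c₁ + c₂, min δ₁ δ₂, by positivity, lt_min hδ₁ hδ₂, ?_⟩
  intro n V hV hV' Ψ BΨ hΨB hΨ M hM k ψ hψ y y'
  obtain ⟨h56k, h56i, hω0, hωlip, h59, -⟩ := H198 n V hV hV' Ψ BΨ hΨB hΨ k ψ hψ
  have hδ1 : min δ₁ δ₂ ≤ δ₁ := min_le_left _ _
  have hδ2 : min δ₁ δ₂ ≤ δ₂ := min_le_right _ _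
  have hδ0' : 0 ≤ min δ₁ δ₂ := (lt_min hδ₁ hδ₂).le
  have hρ0 : (0 : ℝ) ≤ ∑ i, (((y i - y' i).valMinAbs.natAbs : ℕ) : ℝ) := by positivity
  -- abbreviations
  obtain ⟨Ak, hAk⟩ : ∃ Ak : Matrix (Site d (3 ^ k)) (Site d (3 ^ k)) ℝ, Ak = Matrix.of fun y y' : Site d (3 ^ k) =>
      (((n : ℝ) + 1) ^ d)⁻¹ * ∑ z : Fin d → Fin (n + 1), ψ y' (siteOf d ((n + 1) * 3 ^ k) (chart n (windowMap d (3 ^ k) y) z)) :=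
    ⟨_, rfl⟩
  obtain ⟨Ai, hAi⟩ : ∃ Ai : Matrix (Site d (3 ^ k)) (Site d (3 ^ k)) ℝ, Ai = Matrix.of fun y y' : Site d (3 ^ k) =>
      (((n : ℝ) + 1) ^ d)⁻¹ * ∑ q ∈ B n (windowMap d (3 ^ k) y), Ψ (windowMap d (3 ^ k) y') q := ⟨_, rfl⟩
  rw [← hAk] at h56k h59 ⊢
  rw [← hAi] at h56i h59
  -- [B4] (5.10) on the coarse torus, `e = id`
  have h510 := (H5 (Site d (3 ^ k)) (fun x y : Site d (3 ^ k) => ∑ i, (((x i - y i).valMinAbs.natAbs : ℕ) : ℝ))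
    (isPseudoDist_torus (3 ^ k)) (sumBound_torus (3 ^ k)) Ak h56k (Site d (3 ^ k)) id Function.injective_id).2.2
    (Ai - Ak) (fun y => max 0 (((3 ^ k : ℕ) : ℝ) / 2 - 2 - ∑ i, ((((y i).valMinAbs).natAbs : ℕ) : ℝ)))
    (by rw [add_sub_cancel]; exact h56i) hω0 hωlip h59 y y'
  simp only [Matrix.submatrix_id_id, id, add_sub_cancel] at h510
  -- the window section of `T_∞` and the reindexing along `wm : Site d (3^k) ≃ W`
  set W : Finset (X d) := (Finset.univ : Finset (Site d (3 ^ k))).image (windowMap d (3 ^ k)) with hW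
  have hmem : ∀ y : Site d (3 ^ k), windowMap d (3 ^ k) y ∈ W := fun y => Finset.mem_image_of_mem _ (Finset.mem_univ y)
  have hsurj : ∀ b : W, ∃ y : Site d (3 ^ k), windowMap d (3 ^ k) y = (b : X d) := fun b => by
    obtain ⟨y, -, hy⟩ := Finset.mem_image.1 b.2; exact ⟨y, hy⟩
  let ε : Site d (3 ^ k) ≃ W :=
    { toFun := fun y => ⟨windowMap d (3 ^ k) y, hmem y⟩
      invFun := fun b => siteOf d (3 ^ k) (b : X d)
      left_inv := fun y => siteOf_windowMap d (3 ^ k) y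
      right_inv := fun b => Subtype.ext (by obtain ⟨y, hy⟩ := hsurj b; simp only [← hy, siteOf_windowMap]) }
  have hεv : ∀ y, ((ε y : W) : X d) = windowMap d (3 ^ k) y := fun y => rfl
  obtain ⟨AW, hAW⟩ : ∃ AW : Matrix W W ℝ,
      AW = Matrix.of fun b b' : W => (((n : ℝ) + 1) ^ d)⁻¹ * ∑ q ∈ B n (b : X d), Ψ (b' : X d) q := ⟨_, rfl⟩
  have hsub : Ai = AW.submatrix ε ε := by
    rw [hAi, hAW]; ext y y'; simp only [Matrix.submatrix_apply, Matrix.of_apply, hεv]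
  have hinv : Ai⁻¹ y y' = AW⁻¹ (ε y) (ε y') := by
    rw [hsub, Matrix.inv_submatrix_equiv, Matrix.submatrix_apply]
  -- (194): `M` is THE cube limit, and the window section inverse is close to it deep inside the window
  obtain ⟨M₀, hM₀i, -, hM₀iv⟩ := H194 n V hV hV' Ψ BΨ hΨB hΨ
  have hMM₀ : ∀ b b', M b b' = M₀ b b' := fun b b' => tendsto_nhds_unique (hM b b') (hM₀i b b')
  have h58 := hM₀iv W (fun b => max 0 (((3 ^ k : ℕ) : ℝ) / 2 - ∑ j, (((b j).natAbs : ℕ) : ℝ))) (fun b => le_max_left _ _)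
    (fun b _ z hz => max_le (by positivity) (window_margin k b z hz)) (ε y) (ε y')
  rw [← hAW, hεv, hεv, ← hMM₀] at h58
  -- the two error terms, both under `e^{−δ(ω y + ω y′)}`
  have hNy : ∀ y : Site d (3 ^ k), ∑ j, (((windowMap d (3 ^ k) y j).natAbs : ℕ) : ℝ) = ∑ i, ((((y i).valMinAbs).natAbs : ℕ) : ℝ) :=
    fun y => (torusNorm_eq_l1 k y).symm
  have hβω : ∀ y : Site d (3 ^ k), max 0 (((3 ^ k : ℕ) : ℝ) / 2 - 2 - ∑ i, ((((y i).valMinAbs).natAbs : ℕ) : ℝ))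
      ≤ max 0 (((3 ^ k : ℕ) : ℝ) / 2 - ∑ j, (((windowMap d (3 ^ k) y j).natAbs : ℕ) : ℝ)) := fun y => by
    rw [hNy]; exact max_le_max le_rfl (by linarith)
  have hℓ0 : (0 : ℝ) ≤ ∑ i, (((windowMap d (3 ^ k) y i - windowMap d (3 ^ k) y' i).natAbs : ℕ) : ℝ) := by positivity
  have e1 : |Ak⁻¹ y y' - Ai⁻¹ y y'| ≤ c₁ * exp (-(min δ₁ δ₂ * (max 0 (((3 ^ k : ℕ) : ℝ) / 2 - 2 - ∑ i, ((((y i).valMinAbs).natAbs : ℕ) : ℝ))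
      + max 0 (((3 ^ k : ℕ) : ℝ) / 2 - 2 - ∑ i, ((((y' i).valMinAbs).natAbs : ℕ) : ℝ))))) := by
    refine h510.trans (mul_le_mul_of_nonneg_left (exp_le_exp.2 ?_) hc₁.le)
    have := hω0 y; have := hω0 y'
    nlinarith
  have e2 : |Ai⁻¹ y y' - M (windowMap d (3 ^ k) y) (windowMap d (3 ^ k) y')|
      ≤ c₂ * exp (-(min δ₁ δ₂ * (max 0 (((3 ^ k : ℕ) : ℝ) / 2 - 2 - ∑ i, ((((y i).valMinAbs).natAbs : ℕ) : ℝ))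
      + max 0 (((3 ^ k : ℕ) : ℝ) / 2 - 2 - ∑ i, ((((y' i).valMinAbs).natAbs : ℕ) : ℝ))))) := by
    rw [hinv]
    refine h58.trans (mul_le_mul_of_nonneg_left (exp_le_exp.2 ?_) hc₂.le)
    have := hβω y; have := hβω y'; have := hω0 y; have := hω0 y'
    nlinarith
  calc |Ak⁻¹ y y' - M (windowMap d (3 ^ k) y) (windowMap d (3 ^ k) y')|
      ≤ |Ak⁻¹ y y' - Ai⁻¹ y y'| + |Ai⁻¹ y y' - M (windowMap d (3 ^ k) y) (windowMap d (3 ^ k) y')| := abs_sub_le _ _ _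
    _ ≤ _ := by rw [add_mul]; exact add_le_add e1 e2

/-! ## §3. Along the tower `3^k`, at fixed coarse points of `ℤ^d`: convergence with an exponential rate -/

/-- **COROLLARY — THE THERMODYNAMIC LIMIT OF THE NEXT-SCALE HESSIAN KERNEL**: for every `b, b′ ∈ ℤ^d` and ANY family `ψ^k` of torus
block columns along the tower, `T_k⁻¹(σ_k b, σ_k b′) → M(b, b′)` as `k → ∞` — beyond the window radius of `b, b′` the window representatives
are `b, b′` themselves and §2's bound is `≤ c·e^{−δ(3^k − 4 − |b|₁ − |b′|₁)}` ((180) `torusNorm_le_l1`). [folklore] -/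
theorem torus_nextScale_inverse_tendsto (hd : 3 ≤ d) (a : ℝ) (ha : 0 < a) {lam Lam : ℝ} (hlam : lam < min 2 a) (hLam : 0 ≤ Lam)
    (n : ℕ) (V : X d → ℝ) (hV : ∀ p, -lam ≤ V p) (hV' : ∀ p, V p ≤ Lam)
    (Ψ : X d → X d → ℝ) (BΨ : X d → ℝ) (hΨB : ∀ b' p, |Ψ b' p| ≤ BΨ b')
    (hΨ : ∀ b' p, ((n : ℝ) + 1) ^ 2 * ∑ μ, (2 * Ψ b' p - Ψ b' (p + e μ) - Ψ b' (p - e μ))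
      + a / ((n : ℝ) + 1) ^ d * ∑ q ∈ B n (blk n p), Ψ b' q + V p * Ψ b' p = if blk n p = b' then 1 else 0)
    (M : X d → X d → ℝ) (hM : ∀ b b' : X d, Tendsto (fun R : ℕ =>
        if h : b ∈ (Fintype.piFinset fun _ : Fin d => Finset.Icc (-(R : ℤ)) R) ∧
            b' ∈ (Fintype.piFinset fun _ : Fin d => Finset.Icc (-(R : ℤ)) R)
          then (Matrix.of fun c c' : ↥(Fintype.piFinset fun _ : Fin d => Finset.Icc (-(R : ℤ)) R) =>
            (((n : ℝ) + 1) ^ d)⁻¹ * ∑ q ∈ B n (c : X d), Ψ (c' : X d) q)⁻¹ ⟨b, h.1⟩ ⟨b', h.2⟩ else 0)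
      atTop (𝓝 (M b b')))
    (ψ : (k : ℕ) → Site d (3 ^ k) → Site d ((n + 1) * 3 ^ k) → ℝ)
    (hψ : ∀ (k : ℕ) (y' : Site d (3 ^ k)) (x : Site d ((n + 1) * 3 ^ k)),
      ((n : ℝ) + 1) ^ 2 * ∑ μ, (2 * ψ k y' x - ψ k y' (x + siteOf d ((n + 1) * 3 ^ k) (e μ)) - ψ k y' (x - siteOf d ((n + 1) * 3 ^ k) (e μ)))
        + a / ((n : ℝ) + 1) ^ d * ∑ q ∈ B n (blk n (windowMap d ((n + 1) * 3 ^ k) x)), ψ k y' (siteOf d ((n + 1) * 3 ^ k) q)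
        + V (windowMap d ((n + 1) * 3 ^ k) x) * ψ k y' x
        = if siteOf d (3 ^ k) (blk n (windowMap d ((n + 1) * 3 ^ k) x)) = y' then 1 else 0)
    (b b' : X d) :
    Tendsto (fun k : ℕ => (Matrix.of fun y y' : Site d (3 ^ k) =>
        (((n : ℝ) + 1) ^ d)⁻¹ * ∑ z : Fin d → Fin (n + 1), ψ k y' (siteOf d ((n + 1) * 3 ^ k) (chart n (windowMap d (3 ^ k) y) z)))⁻¹
        (siteOf d (3 ^ k) b) (siteOf d (3 ^ k) b')) atTop (𝓝 (M b b')) := by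
  classical
  obtain ⟨c, δ, hc, hδ, H⟩ := torus_nextScale_inverse_close (d := d) hd a ha hlam hLam
  set Bb : ℝ := ∑ i, (((b i).natAbs : ℕ) : ℝ) + ∑ i, (((b' i).natAbs : ℕ) : ℝ) with hBb
  -- beyond the window radius the representatives are `b, b′` and the bound is explicit
  set k₀ : ℕ := 2 * (∑ i, (b i).natAbs + ∑ i, (b' i).natAbs) + 1 with hk₀
  have hwin : ∀ k : ℕ, k₀ ≤ k → ∀ c' : X d, ∑ i, (c' i).natAbs ≤ ∑ i, (b i).natAbs + ∑ i, (b' i).natAbs →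
      windowMap d (3 ^ k) (siteOf d (3 ^ k) c') = c' := fun k hk c' hc' =>
    windowMap_siteOf d (3 ^ k) fun i => by
      have h := inWindow_of_le 0 k c' (by omega) i
      simpa using h
  have hbd : ∀ k : ℕ, k₀ ≤ k → |(Matrix.of fun y y' : Site d (3 ^ k) =>
      (((n : ℝ) + 1) ^ d)⁻¹ * ∑ z : Fin d → Fin (n + 1), ψ k y' (siteOf d ((n + 1) * 3 ^ k) (chart n (windowMap d (3 ^ k) y) z)))⁻¹
        (siteOf d (3 ^ k) b) (siteOf d (3 ^ k) b') - M b b'| ≤ c * exp (-(δ * (((3 ^ k : ℕ) : ℝ) - 4 - Bb))) := by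
    intro k hk
    have h := H n V hV hV' Ψ BΨ hΨB hΨ M hM k (ψ k) (hψ k) (siteOf d (3 ^ k) b) (siteOf d (3 ^ k) b')
    rw [hwin k hk b (by omega), hwin k hk b' (by omega)] at h
    refine h.trans (mul_le_mul_of_nonneg_left (exp_le_exp.2 (neg_le_neg (mul_le_mul_of_nonneg_left ?_ hδ.le))) hc.le)
    have e1 := le_max_right 0 (((3 ^ k : ℕ) : ℝ) / 2 - 2 - ∑ i, (((((siteOf d (3 ^ k) b) i).valMinAbs).natAbs : ℕ) : ℝ))
    have e2 := le_max_right 0 (((3 ^ k : ℕ) : ℝ) / 2 - 2 - ∑ i, (((((siteOf d (3 ^ k) b') i).valMinAbs).natAbs : ℕ) : ℝ))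
    have e3 := torusNorm_le_l1 (d := d) (3 ^ k) b
    have e4 := torusNorm_le_l1 (d := d) (3 ^ k) b'
    rw [hBb]; linarith
  -- the bound tends to zero
  have hg : Tendsto (fun k : ℕ => c * exp (-(δ * (((3 ^ k : ℕ) : ℝ) - 4 - Bb)))) atTop (𝓝 0) := by
    have h3 : Tendsto (fun k : ℕ => ((3 ^ k : ℕ) : ℝ)) atTop atTop :=
      (tendsto_pow_atTop_atTop_of_one_lt (by norm_num : (1 : ℝ) < 3)).congr fun k => by norm_cast
    have h4 : Tendsto (fun k : ℕ => δ * (((3 ^ k : ℕ) : ℝ) - 4 - Bb)) atTop atTop :=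
      ((tendsto_atTop_add_const_right atTop (-4 - Bb) h3).const_mul_atTop hδ).congr fun k => by ring
    have h5 := Real.tendsto_exp_atBot.comp (tendsto_neg_atTop_atBot.comp h4)
    simpa using h5.const_mul c
  -- squeeze
  have hlo : Tendsto (fun k : ℕ => M b b' - c * exp (-(δ * (((3 ^ k : ℕ) : ℝ) - 4 - Bb)))) atTop (𝓝 (M b b')) := by
    have h := tendsto_const_nhds (x := M b b') (f := (atTop : Filter ℕ)) |>.sub hg
    simpa only [sub_zero] using h
  have hhi : Tendsto (fun k : ℕ => M b b' + c * exp (-(δ * (((3 ^ k : ℕ) : ℝ) - 4 - Bb)))) atTop (𝓝 (M b b')) := by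
    have h := tendsto_const_nhds (x := M b b') (f := (atTop : Filter ℕ)) |>.add hg
    simpa only [add_zero] using h
  refine tendsto_of_tendsto_of_tendsto_of_le_of_le' hlo hhi
    (Filter.eventually_atTop.2 ⟨k₀, fun k hk => ?_⟩) (Filter.eventually_atTop.2 ⟨k₀, fun k hk => ?_⟩)
  · have h := (abs_le.1 (hbd k hk)).1; linarith
  · have h := (abs_le.1 (hbd k hk)).2; linarith

/-! ## §4. Toy -/

/-- Toy (`d = 2`, `k = 0`): every point of `ℤ²` outside the one-point window `{0}` of the trivial torus is at `ℓ¹` distance `≥ 1∕2 − |b|₁`. -/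
example (b z : X 2) (hz : z ∉ (Finset.univ : Finset (Site 2 (3 ^ 0))).image (windowMap 2 (3 ^ 0))) :
    ((3 ^ 0 : ℕ) : ℝ) / 2 - ∑ j, (((b j).natAbs : ℕ) : ℝ) ≤ ∑ j, (((b j - z j).natAbs : ℕ) : ℝ) :=
  window_margin (d := 2) 0 b z hz

end Summit.QuantumFields.BalabanUV.T4Continuum.NE7b.SupZdCoarseInverseTorusLimit
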